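import Literature.NumberTheory.Automorphic.UnitaryGroupAutomorphicRep   -- ★ `unitaryGroupOfForm`, `mem_unitaryGroupOfForm_iff`
import Mathlib.LinearAlgebra.SesquilinearForm.Orthogonal                 -- `Submodule.orthogonalBilin`
import Mathlib.LinearAlgebra.Basis.VectorSpace                           -- `Submodule.exists_le_ker_of_lt_top`
import Mathlib.LinearAlgebra.LinearIndependent.Lemmas                    -- `linearIndependent_finCons`, `linearIndependent_finSucc`
import Mathlib.LinearAlgebra.Dimension.Constructions                     -- `finrank_span_eq_card`
import Mathlib.LinearAlgebra.Dimension.Free                              -- `Module.finBasis`, `Module.finBasisOfFinrankEq`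
import Mathlib.LinearAlgebra.FiniteDimensional.Lemmas                    -- `Submodule.finrank_eq_zero`
import Mathlib.LinearAlgebra.Matrix.GeneralLinearGroup.Defs              -- `Matrix.GeneralLinearGroup.mkOfDetNeZero`
import Mathlib.LinearAlgebra.Matrix.Nondegenerate                        -- `Matrix.nondegenerate_of_det_ne_zero`
import Mathlib.LinearAlgebra.Matrix.ToLin                                -- `Matrix.toLin'`, `LinearMap.toMatrix'`
import HarnessLib

/-!
# `K2LiuHermitianWittTransitive` — Witt transitivity on totally isotropic subspaces for `U(J)(L)`
# (socket #12₁ `sig_K2LiuHermitianWittTransitive` of `Cruxes/HLiu418/Lines/K2_Liu_CurveThetaSigs_U3b_Doubling.lean`)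

Track B ∕ K2-LIT, crux hLiu418 = `stmt-HodgeConjecture-24832`, route of record `HCCMUnconditional`;
prover seat `hodgecm-mathlib-K2Liu-p04` (g0); lane `--supports stmt-HodgeConjecture-24832` (count-neutral).
THEOREMS ONLY (no `def`, no `instance`, no notation, no named-fact hypothesis, no `sorry`).

**Statement proved (bytes of the socket, frozen).** For a field `L` with an involutive ring endomorphism
`c` and `2 ≠ 0`, `J ∈ M_N(L)` with `(J.map c)ᵀ = J`, `det J ≠ 0`, and two subspaces `U, U' ≤ L^N` totally
isotropic for `B(x, y) = Σ_i c(x_i) (J y)_i` with `dim U = dim U'`, some `g` in ★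
`Literature.NumberTheory.Automorphic.unitaryGroupOfForm c J ≤ GL_N(L)` maps `U` onto `U'`
(Witt's theorem in transitivity form [Scharlau1985HermitianForms, Ch. 7 Thm. 9.1]; Mathlib has no Witt theorem).

**Proof (elementary).** For an abstract hermitian (`c (B x y) = B y x`), left non-degenerate
`B : V →ₛₗ[c] V →ₗ[L] L` on a finite-dimensional `V`, induction on `k = dim U`:
* `exists_isometry_swap` — for isotropic `u, u'` with `B u u' ≠ 0` (a hyperbolic plane) the explicit map
  `x ↦ x + (B u' x ∕ B u' u)·(λu' − u) + (B u x ∕ B u u')·(u − u')`, `λ = B u' u ∕ B u u'`, is an isometry with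
  `u ↦ λu'` fixing `⟨u, u'⟩^⊥` pointwise (swap on the plane ⊕ identity);
* `exists_forall_apply_eq` ∕ `exists_mem_orthogonal_apply_ne_zero` — non-degeneracy: `y ↦ (B v_i y)_i` is
  onto for a linearly independent family, whence `u ∉ W ⇒ ∃ x ∈ W^⊥, B u x ≠ 0` (`W^⊥⊥ = W`);
* `exists_isotropic_connector` — if `B u u' = 0`, an ISOTROPIC `w ∈ W^⊥` with `B u w ≠ 0 ≠ B u' w`
  (`W^⊥` is not a union of two proper subspaces; `w = x − (B x x ∕ 2 B x u)·u` uses `2 ≠ 0`);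
* `exists_isometry_step` (one swap, or two through `w`), `exists_isometry_map_eq` (induction, `U = ⟨u⟩ ⊔ U₀`),
  and the socket: the isometry's matrix `M` has `(M.map c)ᵀ J M = J` (tested on `Pi.single`), so `det M ≠ 0`.

HONEST LABEL: HC_CM is proved only modulo the 7 printed citations (2 remaining named inputs:
hLiu418 = stmt-HodgeConjecture-24832, h413 = stmt-HodgeConjecture-24833) until rung 0 closes; this file is
road-independent scaffold (#12₁ of the SIG TABLE `Cruxes/HLiu418/Lines/K2_Liu_CurveThetaSigs.md`), moves no counter.

## References
* [Scharlau1985HermitianForms] W. Scharlau, *Quadratic and Hermitian Forms*, Grundlehren 270 (1985), Ch. 7 §9.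
* [Liu2021] Y. Liu, *Fourier–Jacobi cycles and arithmetic relative trace formula*, §B.3 p. 101 (`P_a = Stab V_a^+`).
* [GelbartPiatetskishapiroRallis1987] I. Piatetski-Shapiro, S. Rallis, *L-functions for the classical groups* (Part A of LNM 1254), §2.
-/

set_option autoImplicit false
-- the mandated namespace repeats the single-problem summit's segment (`HodgeConjecture.HodgeConjecture`)
set_option linter.dupNamespace false

namespace Summit.HodgeConjecture.HodgeConjecture.Cruxes.HLiu418.K2LiuHermitianWitt

open Module

variable {L V : Type*} [Field L] [AddCommGroup V] [Module L V] {c : L →+* L}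

/-! ## Abstract `c`-hermitian forms: swap isometries on hyperbolic planes -/

/-- Hermitian symmetry of vanishing: `B x y = 0 → B y x = 0`. [folklore] -/
theorem eq_zero_comm (B : V →ₛₗ[c] V →ₗ[L] L) (hH : ∀ x y, c (B x y) = B y x) {x y : V}
    (h : B x y = 0) : B y x = 0 := by
  rw [← hH x y, h, map_zero]

/-- Hermitian symmetry of non-vanishing: `B x y ≠ 0 → B y x ≠ 0`. [folklore] -/
theorem ne_zero_comm (B : V →ₛₗ[c] V →ₗ[L] L) (hH : ∀ x y, c (B x y) = B y x) {x y : V}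
    (h : B x y ≠ 0) : B y x ≠ 0 :=
  fun h' => h (eq_zero_comm B hH h')

/-- An isometry of a left non-degenerate sesquilinear form is injective. [folklore] -/
theorem injective_of_isometry (B : V →ₛₗ[c] V →ₗ[L] L)
    (hnd : ∀ x, (∀ y, B x y = 0) → x = 0) {g : V →ₗ[L] V}
    (hg : ∀ x y, B (g x) (g y) = B x y) : Function.Injective g := by
  rw [← LinearMap.ker_eq_bot, LinearMap.ker_eq_bot']
  intro x hx
  refine hnd x fun y => ?_
  rw [← hg x y, hx, map_zero, LinearMap.zero_apply]

/-- **Swap on a hyperbolic plane, extended by the identity.** For isotropic `u, u'` with `B u u' ≠ 0`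
(so `⟨u, u'⟩` is a hyperbolic plane and `V = ⟨u, u'⟩ ⊕ ⟨u, u'⟩^⊥`), the explicit linear map
`x ↦ x + (B u' x / B u' u) • (λ • u' - u) + (B u x / B u u') • (u - u')`, `λ = B u' u / B u u'`, is an
isometry of the hermitian form `B`, sends `u ↦ λ • u'`, and fixes every `x` orthogonal to `u` and `u'`.
[cite: Scharlau1985HermitianForms, Ch. 7 §9 (hyperbolic planes)] -/
theorem exists_isometry_swap (B : V →ₛₗ[c] V →ₗ[L] L) (hH : ∀ x y, c (B x y) = B y x)
    {u u' : V} (hu : B u u = 0) (hu' : B u' u' = 0) (hβ : B u u' ≠ 0) :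
    ∃ g : V →ₗ[L] V, (∀ x y, B (g x) (g y) = B x y) ∧
      g u = (B u' u / B u u') • u' ∧ (∀ x, B u x = 0 → B u' x = 0 → g x = x) := by
  have hβ' : B u' u ≠ 0 := ne_zero_comm B hH hβ
  refine ⟨LinearMap.id + (B u').smulRight ((B u' u)⁻¹ • ((B u' u / B u u') • u' - u))
      + (B u).smulRight ((B u u')⁻¹ • (u - u')), ?_, ?_, ?_⟩
  · intro x y
    simp only [LinearMap.add_apply, LinearMap.id_apply, LinearMap.smulRight_apply, map_add, map_sub,
      map_smulₛₗ, LinearMap.add_apply, LinearMap.sub_apply, LinearMap.smul_apply,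
      smul_eq_mul, map_inv₀, map_div₀, RingHom.id_apply, hH, hu, hu']
    field_simp
    ring
  · simp only [LinearMap.add_apply, LinearMap.id_apply, LinearMap.smulRight_apply, hu, zero_mul,
      zero_smul, add_zero, smul_smul, mul_inv_cancel₀ hβ', one_smul]
    abel
  · intro x hux hu'x
    simp only [LinearMap.add_apply, LinearMap.id_apply, LinearMap.smulRight_apply, hux, hu'x,
      zero_smul, add_zero]

/-! ## Non-degeneracy: `W^⊥⊥ = W` in the form we need -/

/-- For a left non-degenerate `c`-sesquilinear form (`c` involutive) and a linearly independent finite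
family `v`, every system `B (v i) y = t i` has a solution (the map `y ↦ (B (v i) y)_i` is onto: else a
non-zero functional `Σ a_i z_i` kills its range and `Σ c(a_i) v_i` lies in the left kernel). [folklore] -/
theorem exists_forall_apply_eq (B : V →ₛₗ[c] V →ₗ[L] L) (hc : ∀ x, c (c x) = x)
    (hnd : ∀ x, (∀ y, B x y = 0) → x = 0)
    {ι : Type*} [Fintype ι] {v : ι → V} (hv : LinearIndependent L v) (t : ι → L) :
    ∃ y : V, ∀ i, B (v i) y = t i := by
  classical
  let Ψ : V →ₗ[L] (ι → L) := LinearMap.pi (fun i => B (v i))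
  suffices h : Function.Surjective Ψ by
    obtain ⟨y, hy⟩ := h t
    exact ⟨y, fun i => by simpa [Ψ] using congr_fun hy i⟩
  rw [← LinearMap.range_eq_top]
  by_contra hne
  obtain ⟨φ, hφ0, hφ⟩ := Submodule.exists_le_ker_of_lt_top _ (lt_top_iff_ne_top.2 hne)
  set a : ι → L := fun i => φ (fun j => if i = j then 1 else 0) with ha
  have key : ∀ y : V, ∑ i, B (v i) y * a i = 0 := by
    intro y
    have h1 : φ (Ψ y) = 0 := by
      have : Ψ y ∈ LinearMap.ker φ := hφ (LinearMap.mem_range_self Ψ y)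
      rwa [LinearMap.mem_ker] at this
    rw [LinearMap.pi_apply_eq_sum_univ φ (Ψ y)] at h1
    simpa [Ψ, smul_eq_mul] using h1
  have hs : ∑ i, c (a i) • v i = 0 := by
    refine hnd _ fun y => ?_
    simp only [map_sum, map_smulₛₗ, LinearMap.sum_apply, LinearMap.smul_apply, smul_eq_mul, hc]
    simpa [mul_comm] using key y
  have ha0 : ∀ i, a i = 0 := fun i => by
    rw [← hc (a i), Fintype.linearIndependent_iff.1 hv (fun i => c (a i)) hs i, map_zero]
  refine hφ0 (LinearMap.ext fun z => ?_)
  rw [LinearMap.pi_apply_eq_sum_univ φ z, LinearMap.zero_apply]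
  refine Finset.sum_eq_zero fun i _ => ?_
  have : φ (fun j => if i = j then 1 else 0) = 0 := ha0 i
  rw [this, smul_zero]

/-- **`W^⊥⊥ = W`, pointwise form.** For a left non-degenerate `c`-sesquilinear form on a
finite-dimensional space and `u ∉ W`, some `x ∈ W^⊥` has `B u x ≠ 0`. [folklore] -/
theorem exists_mem_orthogonal_apply_ne_zero [FiniteDimensional L V] (B : V →ₛₗ[c] V →ₗ[L] L)
    (hc : ∀ x, c (c x) = x) (hnd : ∀ x, (∀ y, B x y = 0) → x = 0)
    (W : Submodule L V) {u : V} (huW : u ∉ W) :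
    ∃ x ∈ W.orthogonalBilin B, B u x ≠ 0 := by
  classical
  let b : Basis (Fin (finrank L W)) L W := Module.finBasis L W
  let v : Fin (finrank L W + 1) → V := Fin.cons u (fun i => (b i : V))
  have hspan : Submodule.span L (Set.range fun i => (b i : V)) = W := by
    rw [show (fun i => (b i : V)) = W.subtype ∘ b from rfl, Set.range_comp, Submodule.span_image,
      b.span_eq, Submodule.map_top, Submodule.range_subtype]
  have hv : LinearIndependent L v :=
    linearIndependent_finCons.2 ⟨b.linearIndependent.map' W.subtype W.ker_subtype, by rwa [hspan]⟩
  obtain ⟨y, hy⟩ := exists_forall_apply_eq B hc hnd hv (Fin.cons 1 (fun _ => 0))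
  refine ⟨y, ?_, ?_⟩
  · rw [Submodule.mem_orthogonalBilin_iff]
    intro w hw
    have hw' : (∑ i, (b.repr ⟨w, hw⟩ i) • (b i : V)) = w := by
      have h := congrArg Subtype.val (b.sum_repr ⟨w, hw⟩)
      simp only [Submodule.coe_sum, Submodule.coe_smul] at h
      exact h
    rw [← hw']
    simp only [map_sum, map_smulₛₗ, LinearMap.sum_apply, LinearMap.smul_apply, smul_eq_mul]
    refine Finset.sum_eq_zero fun i _ => ?_
    have hi := hy (Fin.succ i)
    simp only [v, Fin.cons_succ] at hi
    rw [hi, mul_zero]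
  · have h0 := hy 0
    simp only [v, Fin.cons_zero] at h0
    rw [h0]
    exact one_ne_zero

/-- **Isotropic connector.** `B` hermitian and left non-degenerate, `c` involutive, `2 ≠ 0`: if `u ∈ W^⊥`
is isotropic, `u, u' ∉ W` and `B u u' = 0`, there is an ISOTROPIC `w ∈ W^⊥` with `B u w ≠ 0` and
`B u' w ≠ 0` (`W^⊥` is not the union of the two proper subspaces `u^⊥ ∩ W^⊥`, `u'^⊥ ∩ W^⊥`; then
adjust `x` along `u`: `w = x - (B x x / (2 B x u)) • u`). [folklore] -/
theorem exists_isotropic_connector [FiniteDimensional L V] (B : V →ₛₗ[c] V →ₗ[L] L)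
    (hc : ∀ x, c (c x) = x) (h2 : (2 : L) ≠ 0) (hH : ∀ x y, c (B x y) = B y x)
    (hnd : ∀ x, (∀ y, B x y = 0) → x = 0) (W : Submodule L V) {u u' : V}
    (huo : u ∈ W.orthogonalBilin B) (huW : u ∉ W) (hu'W : u' ∉ W)
    (hu : B u u = 0) (huu' : B u u' = 0) :
    ∃ w ∈ W.orthogonalBilin B, B w w = 0 ∧ B u w ≠ 0 ∧ B u' w ≠ 0 := by
  obtain ⟨x₁, hx₁, h₁⟩ := exists_mem_orthogonal_apply_ne_zero B hc hnd W huW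
  obtain ⟨x₂, hx₂, h₂⟩ := exists_mem_orthogonal_apply_ne_zero B hc hnd W hu'W
  obtain ⟨x, hx, hux, hu'x⟩ : ∃ x ∈ W.orthogonalBilin B, B u x ≠ 0 ∧ B u' x ≠ 0 := by
    by_cases h₁' : B u' x₁ = 0
    · by_cases h₂' : B u x₂ = 0
      · refine ⟨x₁ + x₂, add_mem hx₁ hx₂, ?_, ?_⟩
        · rwa [map_add, h₂', add_zero]
        · rwa [map_add, h₁', zero_add]
      · exact ⟨x₂, hx₂, h₂', h₂⟩
    · exact ⟨x₁, hx₁, h₁, h₁'⟩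
  have hxu : B x u ≠ 0 := ne_zero_comm B hH hux
  refine ⟨x + (-(B x x) / (2 * B x u)) • u, add_mem hx (Submodule.smul_mem _ _ huo), ?_, ?_, ?_⟩
  · simp only [map_add, map_smulₛₗ, LinearMap.add_apply, LinearMap.smul_apply, smul_eq_mul,
      map_neg, map_div₀, map_mul, map_ofNat, RingHom.id_apply, hH, hu]
    field_simp
    ring
  · rwa [map_add, map_smul, hu, smul_zero, add_zero]
  · rwa [map_add, map_smul, eq_zero_comm B hH huu', smul_zero, add_zero]

/-- **One Witt step.** `B` hermitian, left non-degenerate, `c` involutive, `2 ≠ 0`; `W ≤ V`; `u, u' ∈ W^⊥`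
isotropic and not in `W`. Then some isometry of `B` fixes `W` pointwise and maps `u` to a non-zero
multiple of `u'` (one hyperbolic swap if `B u u' ≠ 0`, else two swaps through an isotropic connector).
[cite: Scharlau1985HermitianForms, Ch. 7 Thm. 9.1] -/
theorem exists_isometry_step [FiniteDimensional L V] (B : V →ₛₗ[c] V →ₗ[L] L)
    (hc : ∀ x, c (c x) = x) (h2 : (2 : L) ≠ 0) (hH : ∀ x y, c (B x y) = B y x)
    (hnd : ∀ x, (∀ y, B x y = 0) → x = 0) (W : Submodule L V) {u u' : V}
    (huo : u ∈ W.orthogonalBilin B) (hu'o : u' ∈ W.orthogonalBilin B) (huW : u ∉ W) (hu'W : u' ∉ W)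
    (hu : B u u = 0) (hu' : B u' u' = 0) :
    ∃ g : V →ₗ[L] V, (∀ x y, B (g x) (g y) = B x y) ∧ (∀ x ∈ W, g x = x) ∧
      ∃ r : L, r ≠ 0 ∧ g u = r • u' := by
  have huo' : ∀ x ∈ W, B u x = 0 := fun x hx => eq_zero_comm B hH (huo x hx)
  have hu'o' : ∀ x ∈ W, B u' x = 0 := fun x hx => eq_zero_comm B hH (hu'o x hx)
  by_cases hβ : B u u' = 0
  · obtain ⟨w, hwo, hw, huw, hu'w⟩ := exists_isotropic_connector B hc h2 hH hnd W huo huW hu'W hu hβ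
    have hwo' : ∀ x ∈ W, B w x = 0 := fun x hx => eq_zero_comm B hH (hwo x hx)
    obtain ⟨g₁, hg₁, hg₁u, hfix₁⟩ := exists_isometry_swap B hH hu hw huw
    obtain ⟨g₂, hg₂, hg₂w, hfix₂⟩ := exists_isometry_swap B hH hw hu' (ne_zero_comm B hH hu'w)
    refine ⟨g₂ ∘ₗ g₁, fun x y => by simp only [LinearMap.comp_apply, hg₂, hg₁], fun x hx => ?_,
      (B w u / B u w) * (B u' w / B w u'), mul_ne_zero (div_ne_zero (ne_zero_comm B hH huw) huw)
        (div_ne_zero hu'w (ne_zero_comm B hH hu'w)), ?_⟩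
    · simp only [LinearMap.comp_apply]
      rw [hfix₁ x (huo' x hx) (hwo' x hx), hfix₂ x (hwo' x hx) (hu'o' x hx)]
    · simp only [LinearMap.comp_apply, hg₁u, map_smul, hg₂w, smul_smul]
  · obtain ⟨g, hg, hgu, hfix⟩ := exists_isometry_swap B hH hu hu' hβ
    exact ⟨g, hg, fun x hx => hfix x (huo' x hx) (hu'o' x hx), B u' u / B u u',
      div_ne_zero (ne_zero_comm B hH hβ) hβ, hgu⟩

/-! ## Witt transitivity on totally isotropic subspaces (abstract form) -/

/-- A subspace of dimension `k + 1` splits as `⟨u⟩ ⊔ U₀` with `dim U₀ = k`, `u ∈ U`, `u ∉ U₀ ≤ U`.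
[folklore] -/
theorem exists_decomp [FiniteDimensional L V] (U : Submodule L V) {k : ℕ}
    (hU : finrank L U = k + 1) :
    ∃ (u : V) (U₀ : Submodule L V), U₀ ≤ U ∧ u ∈ U ∧ u ∉ U₀ ∧ finrank L U₀ = k ∧
      U = (L ∙ u) ⊔ U₀ := by
  let b : Basis (Fin (k + 1)) L U := Module.finBasisOfFinrankEq L U hU
  let v : Fin (k + 1) → V := fun i => (b i : V)
  have hv : LinearIndependent L v := b.linearIndependent.map' U.subtype U.ker_subtype
  have hspan : Submodule.span L (Set.range v) = U := by
    rw [show v = U.subtype ∘ b from rfl, Set.range_comp, Submodule.span_image, b.span_eq,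
      Submodule.map_top, Submodule.range_subtype]
  obtain ⟨htail, h0⟩ := linearIndependent_finSucc.1 hv
  refine ⟨v 0, Submodule.span L (Set.range (Fin.tail v)), ?_, (b 0).2, h0, ?_, ?_⟩
  · rw [← hspan]
    refine Submodule.span_mono ?_
    rintro _ ⟨i, rfl⟩
    exact ⟨i.succ, rfl⟩
  · rw [finrank_span_eq_card htail, Fintype.card_fin]
  · rw [← hspan, Fin.range_fin_succ, Submodule.span_insert]

/-- A linear map fixing a subspace pointwise maps it onto itself. [folklore] -/
theorem map_eq_of_forall_eq {g : V →ₗ[L] V} {W : Submodule L V} (h : ∀ x ∈ W, g x = x) :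
    W.map g = W := by
  refine le_antisymm ?_ fun x hx => ⟨x, hx, h x hx⟩
  rintro _ ⟨y, hy, rfl⟩
  rw [h y hy]
  exact hy

/-- **Witt transitivity (abstract).** `L` a field with `2 ≠ 0`, `c` an involutive ring endomorphism,
`B : V →ₛₗ[c] V →ₗ[L] L` hermitian (`c (B x y) = B y x`) and left non-degenerate on a
finite-dimensional `V`. Then for totally isotropic subspaces `U, U'` of the same dimension `k` there is
an isometry `g` of `B` with `g(U) = U'`. Induction on `k`: write `U = ⟨u⟩ ⊔ U₀`, `U' = ⟨u'⟩ ⊔ U₀'`, move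
`U₀` onto `U₀'` by induction, then `u` onto a multiple of `u'` by `exists_isometry_step` with `W = U₀'`.
[cite: Scharlau1985HermitianForms, Ch. 7 Thm. 9.1] -/
theorem exists_isometry_map_eq [FiniteDimensional L V] (B : V →ₛₗ[c] V →ₗ[L] L)
    (hc : ∀ x, c (c x) = x) (h2 : (2 : L) ≠ 0) (hH : ∀ x y, c (B x y) = B y x)
    (hnd : ∀ x, (∀ y, B x y = 0) → x = 0) :
    ∀ (k : ℕ) (U U' : Submodule L V), (∀ u ∈ U, ∀ v ∈ U, B u v = 0) →
      (∀ u ∈ U', ∀ v ∈ U', B u v = 0) → finrank L U = k → finrank L U' = k →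
        ∃ g : V →ₗ[L] V, (∀ x y, B (g x) (g y) = B x y) ∧ U.map g = U' := by
  intro k
  induction k with
  | zero =>
    intro U U' _ _ hU hU'
    rw [Submodule.finrank_eq_zero] at hU hU'
    refine ⟨LinearMap.id, fun _ _ => rfl, ?_⟩
    rw [hU, hU', Submodule.map_bot]
  | succ k ih =>
    intro U U' hUiso hU'iso hU hU'
    obtain ⟨u, U₀, hU₀U, huU, huU₀, hU₀, hUeq⟩ := exists_decomp U hU
    obtain ⟨u', U₀', hU₀'U', hu'U', hu'U₀', hU₀', hU'eq⟩ := exists_decomp U' hU'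
    obtain ⟨g₀, hg₀, hg₀U₀⟩ := ih U₀ U₀' (fun x hx y hy => hUiso x (hU₀U hx) y (hU₀U hy))
      (fun x hx y hy => hU'iso x (hU₀'U' hx) y (hU₀'U' hy)) hU₀ hU₀'
    -- the moved vector `g₀ u` against `W = U₀' = g₀ U₀`
    have h1o : g₀ u ∈ U₀'.orthogonalBilin B := by
      rw [Submodule.mem_orthogonalBilin_iff, ← hg₀U₀]
      rintro _ ⟨w, hw, rfl⟩
      rw [hg₀]
      exact hUiso w (hU₀U hw) u huU
    have h1W : g₀ u ∉ U₀' := by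
      rw [← hg₀U₀]
      rintro ⟨w, hw, hwu⟩
      exact huU₀ (injective_of_isometry B hnd hg₀ hwu ▸ hw)
    have h2o : u' ∈ U₀'.orthogonalBilin B :=
      (Submodule.mem_orthogonalBilin_iff).2 fun w hw => hU'iso w (hU₀'U' hw) u' hu'U'
    obtain ⟨g₁, hg₁, hfix, r, hr, hg₁u⟩ := exists_isometry_step B hc h2 hH hnd U₀' h1o h2o h1W hu'U₀'
      (by rw [hg₀]; exact hUiso u huU u huU) (hU'iso u' hu'U' u' hu'U')
    refine ⟨g₁ ∘ₗ g₀, fun x y => by simp only [LinearMap.comp_apply, hg₁, hg₀], ?_⟩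
    rw [Submodule.map_comp, hUeq, Submodule.map_sup, Submodule.map_sup, hg₀U₀, map_eq_of_forall_eq hfix,
      Submodule.map_span, Submodule.map_span, Set.image_singleton, Set.image_singleton, hg₁u,
      Submodule.span_singleton_smul_eq (isUnit_iff_ne_zero.2 hr), hU'eq]

end Summit.HodgeConjecture.HodgeConjecture.Cruxes.HLiu418.K2LiuHermitianWitt

/-! ## The socket: `U(J)(L)` is transitive on totally isotropic subspaces of equal dimension -/

namespace Summit.HodgeConjecture.HodgeConjecture.Cruxes.HLiu418

open Module K2LiuHermitianWitt
open scoped Matrix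

/-- **Socket #12₁ `sig_K2LiuHermitianWittTransitive` (bytes of
`Cruxes/HLiu418/Lines/K2_Liu_CurveThetaSigs_U3b_Doubling.lean`, frozen), PROVED.** For an involutive
ring endomorphism `c` of a field `L` with `2 ≠ 0`, a matrix `J` with `(J.map c)ᵀ = J` and `det J ≠ 0`,
and two subspaces `U, U' ≤ L^N` totally isotropic for `B(x, y) = Σ c(x_i) J_{ij} y_j` with
`dim U = dim U'`, some `g` in ★ `unitaryGroupOfForm c J ≤ GL_N(L)` maps `U` onto `U'` — Witt's theorem
(transitivity on totally isotropic subspaces) for non-degenerate `c`-hermitian spaces in characteristic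
`≠ 2`. Proof: `K2LiuHermitianWitt.exists_isometry_map_eq` for the concrete form, then the isometry's
matrix `M` satisfies `(M.map c)ᵀ * J * M = J` (tested on the standard basis), so `det M ≠ 0`.
[cite: Scharlau1985HermitianForms, Ch. 7 Thm. 9.1] [cite: Liu2021, §B.3 p. 101 (P_a = Stab V_a^+)]
[cite: GelbartPiatetskishapiroRallis1987, Part A §2] -/
theorem K2LiuHermitianWittTransitive :
    ∀ (L : Type) [Field L] (c : L →+* L), (∀ x, c (c x) = x) → (2 : L) ≠ 0 →
      ∀ (N : ℕ) (J : Matrix (Fin N) (Fin N) L), (J.map c)ᵀ = J → J.det ≠ 0 →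
        ∀ U U' : Submodule L (Fin N → L),
          (∀ u ∈ U, ∀ v ∈ U, dotProduct (fun i => c (u i)) (J.mulVec v) = 0) →
            (∀ u ∈ U', ∀ v ∈ U', dotProduct (fun i => c (u i)) (J.mulVec v) = 0) →
              Module.finrank L U = Module.finrank L U' →
                ∃ g ∈ Literature.NumberTheory.Automorphic.unitaryGroupOfForm c J,
                  U.map (Matrix.toLin' (g : Matrix (Fin N) (Fin N) L)) = U' := by
  intro L _ c hc h2 N J hJ hdet U U' hU hU' hdim
  classical
  -- the `c`-hermitian form of `J`, bundled (its values are the socket's expression by `rfl`)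
  let B : (Fin N → L) →ₛₗ[c] (Fin N → L) →ₗ[L] L :=
    LinearMap.mk₂'ₛₗ c (RingHom.id L) (fun u v => dotProduct (fun i => c (u i)) (J.mulVec v))
      (fun u₁ u₂ v => by
        simp only [dotProduct, Pi.add_apply, map_add, add_mul, Finset.sum_add_distrib])
      (fun a u v => by
        simp only [dotProduct, Pi.smul_apply, smul_eq_mul, map_mul, mul_assoc, ← Finset.mul_sum])
      (fun u v₁ v₂ => by rw [Matrix.mulVec_add, dotProduct_add])
      (fun a u v => by rw [Matrix.mulVec_smul, dotProduct_smul, RingHom.id_apply])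
  have hB : ∀ u v, B u v = dotProduct (fun i => c (u i)) (J.mulVec v) := fun u v => rfl
  have hJ' : ∀ i j, c (J i j) = J j i := fun i j => by
    simpa only [Matrix.transpose_apply, Matrix.map_apply] using congr_fun (congr_fun hJ j) i
  -- hermitian symmetry
  have hH : ∀ x y, c (B x y) = B y x := by
    intro x y
    simp only [hB, dotProduct, Matrix.mulVec, map_sum, map_mul, hc, Finset.mul_sum]
    rw [Finset.sum_comm]
    refine Finset.sum_congr rfl fun i _ => Finset.sum_congr rfl fun j _ => ?_
    rw [hJ' j i]
    ring
  -- left non-degeneracy from `det J ≠ 0`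
  have hnd : ∀ x, (∀ y, B x y = 0) → x = 0 := by
    intro x hx
    have h1 : (fun i => c (x i)) = 0 :=
      (Matrix.nondegenerate_of_det_ne_zero hdet).eq_zero_of_ortho fun w => by rw [← hB]; exact hx w
    funext i
    simpa only [hc, Pi.zero_apply, map_zero] using congrArg c (congr_fun h1 i)
  -- Witt
  obtain ⟨g, hg, hgU⟩ := exists_isometry_map_eq B hc h2 hH hnd (finrank L U) U U'
    (fun u hu v hv => by rw [hB]; exact hU u hu v hv)
    (fun u hu v hv => by rw [hB]; exact hU' u hu v hv) rfl hdim.symm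
  -- the matrix of `g`
  set M : Matrix (Fin N) (Fin N) L := LinearMap.toMatrix' g with hM
  have hgM : Matrix.toLin' M = g := Matrix.toLin'_toMatrix' g
  have hMul : ∀ x, M.mulVec x = g x := fun x => by rw [← Matrix.toLin'_apply, hgM]
  have hsingle : ∀ i : Fin N, (fun k => c ((Pi.single i 1 : Fin N → L) k)) = Pi.single i 1 := by
    refine fun i => funext fun k => ?_
    rcases eq_or_ne k i with rfl | hk
    · simp
    · simp [hk]
  have hmem : (M.map c)ᵀ * J * M = J := by
    ext i j
    have h := hg (Pi.single i 1) (Pi.single j 1)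
    rw [← hMul, ← hMul, hB, hB, hsingle, single_dotProduct, one_mul] at h
    simp only [Matrix.mulVec_single_one] at h
    change (fun k => (M.map c)ᵀ i k) ⬝ᵥ J *ᵥ M.col j = J i j at h
    rw [Matrix.mul_assoc, Matrix.mul_apply']
    have hcol : (fun l => (J * M) l j) = J.mulVec (M.col j) := by
      funext l
      simp [Matrix.mul_apply, Matrix.mulVec, dotProduct, Matrix.col]
    rw [hcol]
    exact h
  have hdetM : M.det ≠ 0 := fun h0 => hdet (by
    simpa only [Matrix.det_mul, h0, mul_zero] using (congrArg Matrix.det hmem).symm)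
  refine ⟨Matrix.GeneralLinearGroup.mkOfDetNeZero M hdetM, ?_, ?_⟩
  · rw [Literature.NumberTheory.Automorphic.mem_unitaryGroupOfForm_iff,
      Matrix.GeneralLinearGroup.val_mkOfDetNeZero]
    exact hmem
  · rw [Matrix.GeneralLinearGroup.val_mkOfDetNeZero, hgM]
    exact hgU

end Summit.HodgeConjecture.HodgeConjecture.Cruxes.HLiu418
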